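import Summits.QuantumFields.YangMills.Theorems.SwapVirialDeficitGnomonicJet
import HarnessLib

/-!
# THIRD-ORDER S-B, part J3a: 3-JETS OF THE COUPLING, PLAQUETTE, WILSON AND SEAM TERMS along a moving quaternion history
# (free-hands support of ⟨stmt-QuantumFields-24197⟩ `SwapVirialDeficit.SwapGluedStiffness`)

The order-three twin of w2 g57's ✓`…GnomonicDeficitSpeed` §§1–3 (`hasDerivAt_qTimeCoupling`, `hasDerivAt_qPlaq`, `hasDerivAt_qWilson`, `hasDerivAt_qSeam`),
GENERIC over a moving quaternion history whose link ∕ site paths carry 3-jets (J1's package ✓`jet3_mul`, ✓`realJet3_re_term`, ✓`realJet3_sum`):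
* §1 `realJet3_mono`, `realJet3_mul_re` (`t ↦ k·re(w t)`), `realJet3_const_sub`;
* §2 ★ `realJet3_qTimeCoupling` — links with jets of sizes `a` (first slot) and `b` (second slot) give `t ↦ qTimeCoupling (U t) (V t)` a real 3-jet with bounds
  `|Edge|·(2(a+b), 2(a+b)², 6(a+b)³)`; ★ `jet3_qPlaq` (the plaquette word: size `4a`); ★ `realJet3_qWilson` (bounds `|Plaquette|·(8a, 32a², 384a³)`);
* §3 ★ `jet3_qSeam` — the σ-glued seam links `g(x)·(±U₀(σe))·ḡ(x')` carry 3-jets of size `M + M + M` when all links ∕ sites carry size `M`.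
Part J3b sums these over ✓`BlowUp.qDeficit`'s slices (`|d³/dt³ qDeficit| ≤ 19872·L⁴·M³`) and instantiates along the gnomonic blow-up (J2b).

HONEST LABEL: calculus bookkeeping (no measure, no estimate on the ring's Gibbs state); nothing about ⟨24197⟩ (window-uniform, OPEN), (LW), (M), (HM) is proved;
⟨24194⟩ ∕ ⟨24196⟩ ∕ ⟨24497⟩ OPEN; item of record ⟨24085⟩ SubOctaveBounded aside ∕ untouched; no crux, rung of record or summit is proved; the Yang–Mills mass gap is
NOT proved; no summit is proved by a line.  THEOREMS ONLY (0 `def`, 0 `sorry`), standard axioms, no local instances.  Seat ym-line-fcl-p3 g47 (cell ym-idea-1,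
free hands), `--supports stmt-QuantumFields-24197`.  References: [cite: Luscher1983, §2] (the ring functional); [folklore] (Leibniz rule).
-/

set_option autoImplicit false

noncomputable section

open Quaternion
open scoped Quaternion BigOperators
open Literature.MathematicalPhysics.QuantumLattice
open Literature.MathematicalPhysics.QuantumFieldTheory hiding SU2
open Summit.QuantumFields.YangMills.Theorems.SwapVirialDeficit.BlowUp (qTimeCoupling qPlaq qWilson qGauge qTwist3 qSwap qSeam qDeficit)

namespace Summit.QuantumFields.YangMills.Theorems.SwapVirialDeficit.Gnomonic

variable {L : ℕ} [NeZero L]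

/-! ## §1 Real 3-jets: monotonicity, `k·re(w)`, `c − φ` -/

omit [NeZero L] in
/-- Weakening the bounds of a real 3-jet. [folklore] -/
theorem realJet3_mono {φ : ℝ → ℝ} {M₁ M₂ M₃ N₁ N₂ N₃ : ℝ} (h₁ : M₁ ≤ N₁) (h₂ : M₂ ≤ N₂) (h₃ : M₃ ≤ N₃)
    (hφ : ∃ d₁ d₂ d₃ : ℝ → ℝ, (∀ t, HasDerivAt φ (d₁ t) t) ∧ (∀ t, HasDerivAt d₁ (d₂ t) t) ∧ (∀ t, HasDerivAt d₂ (d₃ t) t) ∧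
      ∀ t, |d₁ t| ≤ M₁ ∧ |d₂ t| ≤ M₂ ∧ |d₃ t| ≤ M₃) :
    ∃ d₁ d₂ d₃ : ℝ → ℝ, (∀ t, HasDerivAt φ (d₁ t) t) ∧ (∀ t, HasDerivAt d₁ (d₂ t) t) ∧ (∀ t, HasDerivAt d₂ (d₃ t) t) ∧
      ∀ t, |d₁ t| ≤ N₁ ∧ |d₂ t| ≤ N₂ ∧ |d₃ t| ≤ N₃ := by
  obtain ⟨d₁, d₂, d₃, e₁, e₂, e₃, hb⟩ := hφ
  exact ⟨d₁, d₂, d₃, e₁, e₂, e₃, fun t => ⟨(hb t).1.trans h₁, (hb t).2.1.trans h₂, (hb t).2.2.trans h₃⟩⟩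

omit [NeZero L] in
/-- ★ The real term `k·re(w(t))` along a path carrying a 3-jet of size `a`: bounds `|k|a, |k|a², 3|k|a³`. [folklore] -/
theorem realJet3_mul_re {w : ℝ → ℍ} {a : ℝ} (k : ℝ)
    (hw : ∃ w₁ w₂ w₃ : ℝ → ℍ, (∀ t, HasDerivAt w (w₁ t) t) ∧ (∀ t, HasDerivAt w₁ (w₂ t) t) ∧ (∀ t, HasDerivAt w₂ (w₃ t) t) ∧
      ∀ t, ‖w t‖ ≤ 1 ∧ ‖w₁ t‖ ≤ a ∧ ‖w₂ t‖ ≤ a ^ 2 ∧ ‖w₃ t‖ ≤ 3 * a ^ 3) :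
    ∃ d₁ d₂ d₃ : ℝ → ℝ, (∀ t, HasDerivAt (fun t => k * (w t).re) (d₁ t) t) ∧ (∀ t, HasDerivAt d₁ (d₂ t) t) ∧ (∀ t, HasDerivAt d₂ (d₃ t) t) ∧
      ∀ t, |d₁ t| ≤ |k| * a ∧ |d₂ t| ≤ |k| * a ^ 2 ∧ |d₃ t| ≤ |k| * (3 * a ^ 3) := by
  obtain ⟨d₁, d₂, d₃, e₁, e₂, e₃, hb⟩ := realJet3_re_term 0 (-k) hw
  refine ⟨d₁, d₂, d₃, fun t => ?_, e₂, e₃, fun t => by simpa only [abs_neg] using hb t⟩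
  have h := e₁ t
  simp only [neg_mul, zero_sub, neg_neg] at h
  exact h

omit [NeZero L] in
/-- `c − φ` carries the same real 3-jet bounds as `φ`. [folklore] -/
theorem realJet3_const_sub {φ : ℝ → ℝ} {M₁ M₂ M₃ : ℝ} (c : ℝ)
    (hφ : ∃ d₁ d₂ d₃ : ℝ → ℝ, (∀ t, HasDerivAt φ (d₁ t) t) ∧ (∀ t, HasDerivAt d₁ (d₂ t) t) ∧ (∀ t, HasDerivAt d₂ (d₃ t) t) ∧
      ∀ t, |d₁ t| ≤ M₁ ∧ |d₂ t| ≤ M₂ ∧ |d₃ t| ≤ M₃) :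
    ∃ d₁ d₂ d₃ : ℝ → ℝ, (∀ t, HasDerivAt (fun t => c - φ t) (d₁ t) t) ∧ (∀ t, HasDerivAt d₁ (d₂ t) t) ∧ (∀ t, HasDerivAt d₂ (d₃ t) t) ∧
      ∀ t, |d₁ t| ≤ M₁ ∧ |d₂ t| ≤ M₂ ∧ |d₃ t| ≤ M₃ := by
  obtain ⟨d₁, d₂, d₃, e₁, e₂, e₃, hb⟩ := hφ
  refine ⟨fun t => -d₁ t, fun t => -d₂ t, fun t => -d₃ t, fun t => ?_, fun t => (e₂ t).neg, fun t => (e₃ t).neg, fun t => ?_⟩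
  · have h := (e₁ t).const_sub c
    simpa using h
  · simp only [abs_neg]; exact hb t

/-! ## §2 The time coupling, the plaquette word and the Wilson action -/

/-- ★ **`qTimeCoupling` carries a real 3-jet**: links with 3-jets of sizes `a` (first slot) and `b` (second slot) give
`|dᵏ/dtᵏ Σ_e 2 re(U_e V̄_e)| ≤ |Edge|·2(a+b)ᵏ` (`k = 1, 2`) and `≤ |Edge|·6(a+b)³` (`k = 3`). [cite: Luscher1983, §2] -/
theorem realJet3_qTimeCoupling {U V : ℝ → Edge 3 L → ℍ} {a b : ℝ} (ha : 0 ≤ a) (hb : 0 ≤ b)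
    (hU : ∀ e, ∃ f₁ f₂ f₃ : ℝ → ℍ, (∀ t, HasDerivAt (fun t => U t e) (f₁ t) t) ∧ (∀ t, HasDerivAt f₁ (f₂ t) t) ∧ (∀ t, HasDerivAt f₂ (f₃ t) t) ∧
      ∀ t, ‖U t e‖ ≤ 1 ∧ ‖f₁ t‖ ≤ a ∧ ‖f₂ t‖ ≤ a ^ 2 ∧ ‖f₃ t‖ ≤ 3 * a ^ 3)
    (hV : ∀ e, ∃ f₁ f₂ f₃ : ℝ → ℍ, (∀ t, HasDerivAt (fun t => V t e) (f₁ t) t) ∧ (∀ t, HasDerivAt f₁ (f₂ t) t) ∧ (∀ t, HasDerivAt f₂ (f₃ t) t) ∧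
      ∀ t, ‖V t e‖ ≤ 1 ∧ ‖f₁ t‖ ≤ b ∧ ‖f₂ t‖ ≤ b ^ 2 ∧ ‖f₃ t‖ ≤ 3 * b ^ 3) :
    ∃ d₁ d₂ d₃ : ℝ → ℝ, (∀ t, HasDerivAt (fun t => qTimeCoupling (U t) (V t)) (d₁ t) t) ∧ (∀ t, HasDerivAt d₁ (d₂ t) t) ∧
      (∀ t, HasDerivAt d₂ (d₃ t) t) ∧
      ∀ t, |d₁ t| ≤ Fintype.card (Edge 3 L) * (2 * (a + b)) ∧ |d₂ t| ≤ Fintype.card (Edge 3 L) * (2 * (a + b) ^ 2) ∧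
        |d₃ t| ≤ Fintype.card (Edge 3 L) * (6 * (a + b) ^ 3) := by
  have hterm : ∀ e : Edge 3 L, ∃ d₁ d₂ d₃ : ℝ → ℝ, (∀ t, HasDerivAt (fun t => 2 * (U t e * star (V t e)).re) (d₁ t) t) ∧
      (∀ t, HasDerivAt d₁ (d₂ t) t) ∧ (∀ t, HasDerivAt d₂ (d₃ t) t) ∧
      ∀ t, |d₁ t| ≤ 2 * (a + b) ∧ |d₂ t| ≤ 2 * (a + b) ^ 2 ∧ |d₃ t| ≤ 6 * (a + b) ^ 3 := by
    intro e
    have hw := jet3_mul ha hb (hU e) (jet3_star (hV e))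
    have h := realJet3_mul_re 2 hw
    refine realJet3_mono (by norm_num) (by norm_num) (by norm_num; nlinarith [pow_nonneg (add_nonneg ha hb) 3]) h
  have hs := realJet3_sum hterm
  simp only [Finset.sum_const, Finset.card_univ, nsmul_eq_mul] at hs
  exact hs

omit [NeZero L] in
/-- ★ **The plaquette word carries a 3-jet of size `4a`** (links of size `a`; two conjugates). [folklore] -/
theorem jet3_qPlaq {U : ℝ → Edge 3 L → ℍ} {a : ℝ} (ha : 0 ≤ a)
    (hU : ∀ e, ∃ f₁ f₂ f₃ : ℝ → ℍ, (∀ t, HasDerivAt (fun t => U t e) (f₁ t) t) ∧ (∀ t, HasDerivAt f₁ (f₂ t) t) ∧ (∀ t, HasDerivAt f₂ (f₃ t) t) ∧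
      ∀ t, ‖U t e‖ ≤ 1 ∧ ‖f₁ t‖ ≤ a ∧ ‖f₂ t‖ ≤ a ^ 2 ∧ ‖f₃ t‖ ≤ 3 * a ^ 3)
    (x : Site 3 L) (i j : Fin 3) :
    ∃ f₁ f₂ f₃ : ℝ → ℍ, (∀ t, HasDerivAt (fun t => qPlaq (U t) x i j) (f₁ t) t) ∧ (∀ t, HasDerivAt f₁ (f₂ t) t) ∧ (∀ t, HasDerivAt f₂ (f₃ t) t) ∧
      ∀ t, ‖qPlaq (U t) x i j‖ ≤ 1 ∧ ‖f₁ t‖ ≤ 4 * a ∧ ‖f₂ t‖ ≤ (4 * a) ^ 2 ∧ ‖f₃ t‖ ≤ 3 * (4 * a) ^ 3 := by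
  have h2 := jet3_mul ha ha (hU (x, i)) (hU (x.shift i, j))
  have h3 := jet3_mul (add_nonneg ha ha) ha h2 (jet3_star (hU (x.shift j, i)))
  have h4 := jet3_mul (add_nonneg (add_nonneg ha ha) ha) ha h3 (jet3_star (hU (x, j)))
  have e : a + a + a + a = 4 * a := by ring
  rw [e] at h4
  simpa only [qPlaq] using h4

/-- ★ **`qWilson` carries a real 3-jet**: `|dᵏ/dtᵏ Σ_p (2 − 2 re(plaquette))| ≤ |Plaquette|·(8a, 32a², 384a³)`. [cite: Luscher1983, §2] -/
theorem realJet3_qWilson {U : ℝ → Edge 3 L → ℍ} {a : ℝ} (ha : 0 ≤ a)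
    (hU : ∀ e, ∃ f₁ f₂ f₃ : ℝ → ℍ, (∀ t, HasDerivAt (fun t => U t e) (f₁ t) t) ∧ (∀ t, HasDerivAt f₁ (f₂ t) t) ∧ (∀ t, HasDerivAt f₂ (f₃ t) t) ∧
      ∀ t, ‖U t e‖ ≤ 1 ∧ ‖f₁ t‖ ≤ a ∧ ‖f₂ t‖ ≤ a ^ 2 ∧ ‖f₃ t‖ ≤ 3 * a ^ 3) :
    ∃ d₁ d₂ d₃ : ℝ → ℝ, (∀ t, HasDerivAt (fun t => qWilson (U t)) (d₁ t) t) ∧ (∀ t, HasDerivAt d₁ (d₂ t) t) ∧ (∀ t, HasDerivAt d₂ (d₃ t) t) ∧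
      ∀ t, |d₁ t| ≤ Fintype.card (Plaquette 3 L) * (8 * a) ∧ |d₂ t| ≤ Fintype.card (Plaquette 3 L) * (32 * a ^ 2) ∧
        |d₃ t| ≤ Fintype.card (Plaquette 3 L) * (384 * a ^ 3) := by
  have hterm : ∀ p : Plaquette 3 L, ∃ d₁ d₂ d₃ : ℝ → ℝ, (∀ t, HasDerivAt (fun t => 2 - 2 * (qPlaq (U t) p.1 p.2.1.1 p.2.1.2).re) (d₁ t) t) ∧
      (∀ t, HasDerivAt d₁ (d₂ t) t) ∧ (∀ t, HasDerivAt d₂ (d₃ t) t) ∧ ∀ t, |d₁ t| ≤ 8 * a ∧ |d₂ t| ≤ 32 * a ^ 2 ∧ |d₃ t| ≤ 384 * a ^ 3 := by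
    intro p
    have h := realJet3_re_term 2 2 (jet3_qPlaq ha hU p.1 p.2.1.1 p.2.1.2)
    refine realJet3_mono ?_ ?_ ?_ h
    · rw [abs_two]; linarith
    · rw [abs_two]; nlinarith
    · rw [abs_two]; nlinarith [pow_nonneg ha 3]
  have hs := realJet3_sum hterm
  simp only [Finset.sum_const, Finset.card_univ, nsmul_eq_mul] at hs
  simpa only [qWilson] using hs

/-! ## §3 The σ-glued seam -/

omit [NeZero L] in
/-- ★ **The σ-glued seam links carry 3-jets of size `M + M + M`** along a history whose links and sites carry 3-jets of size `M`
(a word `g(x)·(±U₀(σe))·ḡ(x')`; ✓`qSeam`, ✓`qTwist3`, ✓`qSwap`). [cite: tHooft1979] -/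
theorem jet3_qSeam (z : Fin 3 → Bool) {Q : ℝ → (Fin (2 * L - 1 + 1) → Edge 3 L → ℍ) × (Site 3 L → ℍ)} {M : ℝ} (hM : 0 ≤ M)
    (h1 : ∀ i e, ∃ f₁ f₂ f₃ : ℝ → ℍ, (∀ t, HasDerivAt (fun t => (Q t).1 i e) (f₁ t) t) ∧ (∀ t, HasDerivAt f₁ (f₂ t) t) ∧ (∀ t, HasDerivAt f₂ (f₃ t) t) ∧
      ∀ t, ‖(Q t).1 i e‖ ≤ 1 ∧ ‖f₁ t‖ ≤ M ∧ ‖f₂ t‖ ≤ M ^ 2 ∧ ‖f₃ t‖ ≤ 3 * M ^ 3)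
    (h2 : ∀ x, ∃ f₁ f₂ f₃ : ℝ → ℍ, (∀ t, HasDerivAt (fun t => (Q t).2 x) (f₁ t) t) ∧ (∀ t, HasDerivAt f₁ (f₂ t) t) ∧ (∀ t, HasDerivAt f₂ (f₃ t) t) ∧
      ∀ t, ‖(Q t).2 x‖ ≤ 1 ∧ ‖f₁ t‖ ≤ M ∧ ‖f₂ t‖ ≤ M ^ 2 ∧ ‖f₃ t‖ ≤ 3 * M ^ 3) (e : Edge 3 L) :
    ∃ f₁ f₂ f₃ : ℝ → ℍ, (∀ t, HasDerivAt (fun t => qSeam z (Q t) e) (f₁ t) t) ∧ (∀ t, HasDerivAt f₁ (f₂ t) t) ∧ (∀ t, HasDerivAt f₂ (f₃ t) t) ∧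
      ∀ t, ‖qSeam z (Q t) e‖ ≤ 1 ∧ ‖f₁ t‖ ≤ M + M + M ∧ ‖f₂ t‖ ≤ (M + M + M) ^ 2 ∧ ‖f₃ t‖ ≤ 3 * (M + M + M) ^ 3 := by
  set e' : Edge 3 L := (sitePerm (L := L) (Equiv.swap (0 : Fin 3) 1).symm e.1, (Equiv.swap (0 : Fin 3) 1).symm e.2) with he'
  have hmid : ∃ f₁ f₂ f₃ : ℝ → ℍ, (∀ t, HasDerivAt (fun t => qTwist3 z (qSwap ((Q t).1 0)) e) (f₁ t) t) ∧ (∀ t, HasDerivAt f₁ (f₂ t) t) ∧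
      (∀ t, HasDerivAt f₂ (f₃ t) t) ∧ ∀ t, ‖qTwist3 z (qSwap ((Q t).1 0)) e‖ ≤ 1 ∧ ‖f₁ t‖ ≤ M ∧ ‖f₂ t‖ ≤ M ^ 2 ∧ ‖f₃ t‖ ≤ 3 * M ^ 3 := by
    by_cases hc : e.1 e.2 = 0 ∧ z e.2 = true
    · have ef : ∀ t, qTwist3 z (qSwap ((Q t).1 0)) e = -((Q t).1 0 e') := fun t => by
        simp only [qTwist3, qSwap, hc, and_self, if_true, he']
      simp only [ef]
      exact jet3_neg (h1 0 e')
    · have ef : ∀ t, qTwist3 z (qSwap ((Q t).1 0)) e = (Q t).1 0 e' := fun t => by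
        simp only [qTwist3, qSwap, hc, if_false, he']
      simp only [ef]
      exact h1 0 e'
  have hA := jet3_mul hM hM (h2 e.1) hmid
  have hB := jet3_mul (add_nonneg hM hM) hM hA (jet3_star (h2 (e.1.shift e.2)))
  simpa only [qSeam, qGauge] using hB

end Summit.QuantumFields.YangMills.Theorems.SwapVirialDeficit.Gnomonic

end
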